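import Mathlib

/-!
# Cube obstruction for 2-token separation — candidate `Negative/` lemma (ideator 2, crux 7612)

Sorry-free target: `cube_obstruction`.  If `(X, Y, Z) ⊆ 𝔖ₙ` is 2-token separated (first conjunct of
`LevelGradedCohnUmans.LevelTwoBeatsCubes`, restated verbatim as `TwoTokenSeparated`), then for
`x₀ ≠ x₁ ∈ X`, `y ≠ y' ∈ Y`, `z₀ ≠ z₁ ∈ Z` the three differences `x₀x₁⁻¹`, `yy'⁻¹`, `z₁z₀⁻¹` are not
pairwise disjoint permutations.  Proof: the separator of the target `(x₀, z₀)` has alternating sum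
`1` over the eight cube vertices `x₀⁻¹ σ₁^a σ₂^b σ₃^c z₀`, while every 2-token test has alternating
sum `0` (two probed points see at most two of the three disjoint toggles).
-/

open scoped BigOperators

namespace Summit.MatrixMultiplication.MatrixMultiplication.Cruxes.LevelTwoBeatsCubes.Ideator2

/-- 2-token separation: the first conjunct of `LevelTwoBeatsCubes`, verbatim. -/
def TwoTokenSeparated {n : ℕ} (X Y Z : Finset (Equiv.Perm (Fin n))) : Prop :=
  ∀ x₀ ∈ X, ∀ z₀ ∈ Z, ∃ c : (Fin 2 → Fin n) → (Fin 2 → Fin n) → ℂ,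
    ∀ x ∈ X, ∀ y ∈ Y, ∀ y' ∈ Y, ∀ z ∈ Z,
      (∑ p : Fin 2 → Fin n, c p (⇑(x⁻¹ * y * y'⁻¹ * z) ∘ p)) =
        if x = x₀ ∧ y = y' ∧ z = z₀ then 1 else 0

/-- `pw σ b` is `σ` if `b = true` and `1` otherwise. -/
def pw {n : ℕ} (σ : Equiv.Perm (Fin n)) (b : Bool) : Equiv.Perm (Fin n) := bif b then σ else 1

@[simp] lemma pw_true {n : ℕ} (σ : Equiv.Perm (Fin n)) : pw σ true = σ := rfl
@[simp] lemma pw_false {n : ℕ} (σ : Equiv.Perm (Fin n)) : pw σ false = 1 := rfl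

/-- A point is either fixed by `pw σ b`, or its image is moved by `σ`. -/
lemma pw_apply_fixed_or_moved {n : ℕ} (σ : Equiv.Perm (Fin n)) (b : Bool) (u : Fin n) :
    pw σ b u = u ∨ σ (pw σ b u) ≠ pw σ b u := by
  cases b
  · left; simp
  · simp only [pw_true]
    by_cases h : σ u = u
    · left; exact h
    · right
      intro h'
      exact h (σ.injective h')

/-- Signs `(-1)^b`. -/
def sg (b : Bool) : ℂ := bif b then -1 else 1

@[simp] lemma sg_true : sg true = -1 := rfl
@[simp] lemma sg_false : sg false = 1 := rfl

lemma alt_sum_eq_zero₁ (F : Bool → Bool → Bool → ℂ) (h : ∀ b e, F true b e = F false b e) :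
    (∑ a : Bool, ∑ b : Bool, ∑ e : Bool, sg a * sg b * sg e * F a b e) = 0 := by
  simp only [Fintype.sum_bool, sg_true, sg_false, h]; ring

lemma alt_sum_eq_zero₂ (F : Bool → Bool → Bool → ℂ) (h : ∀ a e, F a true e = F a false e) :
    (∑ a : Bool, ∑ b : Bool, ∑ e : Bool, sg a * sg b * sg e * F a b e) = 0 := by
  simp only [Fintype.sum_bool, sg_true, sg_false, h]; ring

lemma alt_sum_eq_zero₃ (F : Bool → Bool → Bool → ℂ) (h : ∀ a b, F a b true = F a b false) :
    (∑ a : Bool, ∑ b : Bool, ∑ e : Bool, sg a * sg b * sg e * F a b e) = 0 := by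
  simp only [Fintype.sum_bool, sg_true, sg_false, h]; ring

/-- **Cube obstruction.**  A 2-token separated triple has no pairwise disjoint triple of
differences `x₀x₁⁻¹ ∈ XX⁻¹`, `yy'⁻¹ ∈ YY⁻¹`, `z₁z₀⁻¹ ∈ ZZ⁻¹`. -/
theorem cube_obstruction {n : ℕ} {X Y Z : Finset (Equiv.Perm (Fin n))}
    (hsep : TwoTokenSeparated X Y Z)
    {x₀ x₁ y y' z₀ z₁ : Equiv.Perm (Fin n)}
    (hx₀ : x₀ ∈ X) (hx₁ : x₁ ∈ X) (hy : y ∈ Y) (hy' : y' ∈ Y) (hz₀ : z₀ ∈ Z) (hz₁ : z₁ ∈ Z)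
    (h₁ : x₀ ≠ x₁) (h₂ : y ≠ y') (h₃ : z₀ ≠ z₁)
    (d₁₂ : Equiv.Perm.Disjoint (x₀ * x₁⁻¹) (y * y'⁻¹))
    (d₁₃ : Equiv.Perm.Disjoint (x₀ * x₁⁻¹) (z₁ * z₀⁻¹))
    (d₂₃ : Equiv.Perm.Disjoint (y * y'⁻¹) (z₁ * z₀⁻¹)) : False := by
  classical
  obtain ⟨c, hc⟩ := hsep x₀ hx₀ z₀ hz₀
  set σ₁ : Equiv.Perm (Fin n) := x₀ * x₁⁻¹ with hσ₁
  set σ₂ : Equiv.Perm (Fin n) := y * y'⁻¹ with hσ₂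
  set σ₃ : Equiv.Perm (Fin n) := z₁ * z₀⁻¹ with hσ₃
  -- pointwise cube map and cube vertices
  let T : Bool → Bool → Bool → Fin n → Fin n := fun a b e u => pw σ₁ a (pw σ₂ b (pw σ₃ e u))
  let g : Bool → Bool → Bool → Equiv.Perm (Fin n) :=
    fun a b e => x₀⁻¹ * (pw σ₁ a * pw σ₂ b * pw σ₃ e) * z₀
  have g_apply : ∀ a b e (u : Fin n), g a b e u = x₀⁻¹ (T a b e (z₀ u)) := by
    intro a b e u; simp [g, T, Equiv.Perm.mul_apply]
  -- Step 1: the separator's values on the cube vertices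
  have hval : ∀ a b e : Bool,
      (∑ p : Fin 2 → Fin n, c p (⇑(g a b e) ∘ p)) =
        if (a = false ∧ b = false ∧ e = false) then 1 else 0 := by
    intro a b e
    have hxa : (bif a then x₁ else x₀) ∈ X := by cases a <;> assumption
    have hyb : (bif b then y' else y) ∈ Y := by cases b <;> assumption
    have hze : (bif e then z₁ else z₀) ∈ Z := by cases e <;> assumption
    have key := hc _ hxa y hy _ hyb _ hze
    have hg : (bif a then x₁ else x₀)⁻¹ * y * (bif b then y' else y)⁻¹ * (bif e then z₁ else z₀)
        = g a b e := by
      cases a <;> cases b <;> cases e <;>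
        simp only [g, pw_true, pw_false, hσ₁, hσ₂, hσ₃, cond_true, cond_false] <;> group
    have hcond : ((bif a then x₁ else x₀) = x₀ ∧ y = (bif b then y' else y) ∧
          (bif e then z₁ else z₀) = z₀) ↔ (a = false ∧ b = false ∧ e = false) := by
      cases a <;> cases b <;> cases e <;> simp [Ne.symm h₁, h₂, Ne.symm h₃]
    rw [hg] at key
    rw [key]
    exact if_congr hcond rfl rfl
  -- Step 2: the alternating sum of the separator over the cube is 1
  have hone : (∑ a : Bool, ∑ b : Bool, ∑ e : Bool,
      sg a * sg b * sg e * ∑ p : Fin 2 → Fin n, c p (⇑(g a b e) ∘ p)) = 1 := by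
    simp only [hval, Fintype.sum_bool, sg_true, sg_false]
    norm_num
  -- Step 3: for each 2-tuple of probes the alternating sum vanishes
  have hzero_p : ∀ p : Fin 2 → Fin n,
      (∑ a : Bool, ∑ b : Bool, ∑ e : Bool,
        sg a * sg b * sg e * c p (⇑(g a b e) ∘ p)) = 0 := by
    intro p
    have htup : ∀ a b e, (⇑(g a b e) ∘ p) = fun i => x₀⁻¹ (T a b e (z₀ (p i))) := by
      intro a b e; funext i; simp [Function.comp, g_apply]
    simp only [htup]
    have f12 : ∀ v, σ₂ v ≠ v → σ₁ v = v := fun v hv => (d₁₂ v).resolve_right hv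
    have f21 : ∀ v, σ₁ v ≠ v → σ₂ v = v := fun v hv => (d₁₂ v).resolve_left hv
    have f13 : ∀ v, σ₃ v ≠ v → σ₁ v = v := fun v hv => (d₁₃ v).resolve_right hv
    have f23 : ∀ v, σ₃ v ≠ v → σ₂ v = v := fun v hv => (d₂₃ v).resolve_right hv
    by_cases hA : ∀ i : Fin 2, σ₁ (z₀ (p i)) = z₀ (p i)
    · -- the toggle `a` is invisible
      refine alt_sum_eq_zero₁ (fun a b e => c p (fun i => x₀⁻¹ (T a b e (z₀ (p i))))) ?_
      intro b e
      show c p (fun i => x₀⁻¹ (T true b e (z₀ (p i)))) = c p (fun i => x₀⁻¹ (T false b e (z₀ (p i))))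
      congr 1
      funext i
      simp only [T, pw_true, pw_false, Equiv.Perm.one_apply]
      congr 1
      rcases pw_apply_fixed_or_moved σ₂ b (pw σ₃ e (z₀ (p i))) with h2 | h2
      · rw [h2]
        rcases pw_apply_fixed_or_moved σ₃ e (z₀ (p i)) with h3 | h3
        · rw [h3]; exact hA i
        · exact f13 _ h3
      · exact f12 _ h2
    · push_neg at hA
      obtain ⟨i₁, hi₁⟩ := hA
      by_cases hB : ∀ i : Fin 2, σ₂ (z₀ (p i)) = z₀ (p i)
      · -- the toggle `b` is invisible
        refine alt_sum_eq_zero₂ (fun a b e => c p (fun i => x₀⁻¹ (T a b e (z₀ (p i))))) ?_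
        intro a e
        show c p (fun i => x₀⁻¹ (T a true e (z₀ (p i)))) = c p (fun i => x₀⁻¹ (T a false e (z₀ (p i))))
        congr 1
        funext i
        simp only [T, pw_true, pw_false, Equiv.Perm.one_apply]
        congr 2
        rcases pw_apply_fixed_or_moved σ₃ e (z₀ (p i)) with h3 | h3
        · rw [h3]; exact hB i
        · exact f23 _ h3
      · push_neg at hB
        obtain ⟨i₂, hi₂⟩ := hB
        -- then `σ₃` fixes both probed points
        have hC : ∀ i : Fin 2, σ₃ (z₀ (p i)) = z₀ (p i) := by
          intro i
          by_contra h3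
          have e1 : σ₁ (z₀ (p i)) = z₀ (p i) := f13 _ h3
          have e2 : σ₂ (z₀ (p i)) = z₀ (p i) := f23 _ h3
          have n1 : i₁ ≠ i := fun h => hi₁ (h ▸ e1)
          have n2 : i₂ ≠ i := fun h => hi₂ (h ▸ e2)
          have h12 : i₁ = i₂ := by omega
          subst h12
          exact hi₂ (f21 _ hi₁)
        refine alt_sum_eq_zero₃ (fun a b e => c p (fun i => x₀⁻¹ (T a b e (z₀ (p i))))) ?_
        intro a b
        show c p (fun i => x₀⁻¹ (T a b true (z₀ (p i)))) = c p (fun i => x₀⁻¹ (T a b false (z₀ (p i))))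
        congr 1
        funext i
        simp only [T, pw_true, pw_false, Equiv.Perm.one_apply, hC i]
  -- Step 4: exchange the sums: the total alternating sum is 0, contradiction
  have hzero : (∑ a : Bool, ∑ b : Bool, ∑ e : Bool,
      sg a * sg b * sg e * ∑ p : Fin 2 → Fin n, c p (⇑(g a b e) ∘ p)) = 0 := by
    have hx : (∑ a : Bool, ∑ b : Bool, ∑ e : Bool,
        sg a * sg b * sg e * ∑ p : Fin 2 → Fin n, c p (⇑(g a b e) ∘ p))
        = ∑ p : Fin 2 → Fin n, ∑ a : Bool, ∑ b : Bool, ∑ e : Bool,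
            sg a * sg b * sg e * c p (⇑(g a b e) ∘ p) := by
      simp only [Finset.mul_sum]
      calc (∑ a : Bool, ∑ b : Bool, ∑ e : Bool, ∑ p : Fin 2 → Fin n,
              sg a * sg b * sg e * c p (⇑(g a b e) ∘ p))
          = ∑ a : Bool, ∑ b : Bool, ∑ p : Fin 2 → Fin n, ∑ e : Bool,
              sg a * sg b * sg e * c p (⇑(g a b e) ∘ p) := by
            refine Finset.sum_congr rfl (fun a _ => Finset.sum_congr rfl (fun b _ => ?_))
            exact Finset.sum_comm
        _ = ∑ a : Bool, ∑ p : Fin 2 → Fin n, ∑ b : Bool, ∑ e : Bool,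
              sg a * sg b * sg e * c p (⇑(g a b e) ∘ p) := by
            refine Finset.sum_congr rfl (fun a _ => ?_)
            exact Finset.sum_comm
        _ = ∑ p : Fin 2 → Fin n, ∑ a : Bool, ∑ b : Bool, ∑ e : Bool,
              sg a * sg b * sg e * c p (⇑(g a b e) ∘ p) := Finset.sum_comm
    rw [hx]
    exact Finset.sum_eq_zero (fun p _ => hzero_p p)
  rw [hzero] at hone
  exact zero_ne_one hone

end Summit.MatrixMultiplication.MatrixMultiplication.Cruxes.LevelTwoBeatsCubes.Ideator2
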